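import Summits.ResolutionOfSingularities.ResolutionOfSingularities.Theorems.WeightedInvariantIota3SigmaMaximiserOfLevelBound
import Summits.ResolutionOfSingularities.ResolutionOfSingularities.Theorems.WeightedInvariantIota3TwoFlagCompletion
import Summits.ResolutionOfSingularities.ResolutionOfSingularities.Theorems.WeightedInvariantJOpenPresentationDivisorial
import Summits.ResolutionOfSingularities.ResolutionOfSingularities.Theorems.WeightedInvariantContactCylinderConsistency
import Mathlib.RingTheory.Ideal.KrullsHeightTheorem
import HarnessLib

/-!
# P3c≤3: the (o70-a) body `SigmaMaximiserExistsLE3Body` and the (σ-pres)₃ body `SigmaPresentationLE3Body`, MODULO the uniform level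
# bound (EX-4) and the canonicity (J-can) — the closers of res-L1-w43-plan-1's SPEC (Δ12) `JSigmaCanon_sketch.lean` (aceffaa8e08fb006)
# (door `HypersurfaceCentreConstruction`, stmt-ResolutionOfSingularities-19897; P3 rung clause h8 via the point bodies (P₀₀)/(P₀₁); hand res-D-pv-038)

Topic: `Summits/ResolutionOfSingularities/ResolutionOfSingularities/Theorems`. Helper for the door item `HypersurfaceCentreConstruction`
(stmt-ResolutionOfSingularities-19897, route `WeightedInvariant`), line `local-engine` (L W4.3), def-free.  The point bodies (P₀₀)/(P₀₁) of h8
(`JOpenLE3.pointBodyLE3_zero_zero_of` p560019, `…_zero_one_of` p562344) are conditional on ONE hypothesis (σ-pres)₃ =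
`SigmaPresentationLE3Body p` (SPEC (Δ12) l.147), which the registrar's glue `sigmaPresentationLE3Body_of_bodies` derives from
(o70-a) EXISTENCE + (o70-b) CANONICITY + (o70-x) the r.s.p. completion (res-D-pv-048, `Iota3.exists_span_triple_of_isTwoFlag`, p562089).
THIS FILE lands the two closers in def-free form, with the research residuals NAMED and spelled out:

* (EX-4) **uniform level bound** — at a dimension-`3` point-centre position (`ε ≠ 1`) of a regular local ring essentially of finite type
  over a perfect field of characteristic `p`, SOME `L` bounds `r₁ ≤ L q` for every two-flag reaching a maximal-ratio admissible triple
  `(q ; r₁, r₂)` (text `hlev` below; the two-flag termination-of-steepening, res-D-pv-038 DESIGN + SIZING 2026-08-27T19:32:22Z);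
* (J-can) **canonicity** = res-D-brk-1's (o70-b) body `JSigmaCanonicalLE3Body p` VERBATIM (SPEC (Δ12) l.121; text `hcan` below).

§1 `not_isMonomialType_of_topStratumPrime_eq_maximalIdeal` — a dimension-`3` position whose top `ι₀`-stratum is the closed point is not
of monomial type (its `ι₀`-stratum would be the divisor `V(g)`).  §2 **`sigmaMaximiserExistsLE3_of_levelBound (hlev) : SigmaMaximiserExistsLE3Body-text`**
(= (o70-a) modulo (EX-4), over `RatContact.exists_isSigmaMaximiser_of_levelBound`).  §3 the SPEC's consumers of (J-can) re-proved def-free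
(`jSigmaPtLocal_eq_flagContactFiltration_of_canonical`, `jFlatT_eq_weightedMonomialIdeal_of_canonical`) and
**`sigmaPresentationLE3_of_levelBound_of_canonical (hlev) (hcan) : SigmaPresentationLE3Body-text`** — so that
h8 ⟸ {(Δ10-d) ✓, (P₁₀) ✓, (EX-4), (J-can)}.

[OURS · L1 W4.3 · (o70-a)/(σ-pres)₃ closers]  Replaces the role of NO printed item; NOT a statement of the manuscript
[claim: Hironaka2017, status: under-review]. AI work, weaker than expert review.  Pure commutative algebra; no named facts; the hypotheses
(EX-4) and (J-can) are CANDIDATE obligations of OUR line, spelled out in the signatures, never discharged by assumption elsewhere.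

## References

* D. Abramovich, M. Temkin, J. Włodarczyk, *Functorial embedded resolution via weighted blowings up*, Algebra & Number Theory 18 (2024), §5.
  [AbramovichTemkinWlodarczyk2024]
* J. Włodarczyk, *Functorial resolution except for toroidal locus. Toroidal compactification*, Adv. Math. 407 (2022), Lemma 2.1.12. [Wlodarczyk2022]
* res-L1-w43-plan-1, SPEC (Δ12) rev 2 `JSigmaCanon_sketch.lean` aceffaa8e08fb006, RULING h8 POINT BODIES 2026-08-27T19:09:30Z (OURS, AI planning).
-/

noncomputable section

open IsLocalRing Literature.AlgebraicGeometry.Resolution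
open Summit.ResolutionOfSingularities.ResolutionOfSingularities.Theorems
open Summit.ResolutionOfSingularities.ResolutionOfSingularities.Theorems.ContactCylinder

set_option linter.dupNamespace false -- mandated namespace of this single-conjunct summit

namespace Summit.ResolutionOfSingularities.ResolutionOfSingularities.Cruxes.HypersurfaceCentreConstruction.LocalEngine

namespace Iota3

/-! ## §1 A point-centre position of dimension three is not of monomial type -/

/-- **At a dimension-`3` position whose top `(ν ; ε ; τ)`-stratum is the closed point, `f ∈ 𝔪` is NOT of monomial type**: for `f = v gⁿ`
the letters are `(n ; 0 ; 0)` (res-D-brk-1's `letters_of_eq_unit_mul_pow`), the `ι₀`-stratum is the `(ν ; ε)`-stratum `V(g)`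
(res-type-013, res-type-005), so its generic prime `(g)` would be `𝔪` — of height `≤ 1` (Krull), not `3`. [OURS · L1 W4.3] -/
theorem not_isMonomialType_of_topStratumPrime_eq_maximalIdeal {S : Type} [CommRing S] [IsRegularLocalRing S]
    (hdim : ringKrullDim S = (3 : ℕ)) {f : S} (hf : f ∈ maximalIdeal S)
    (htop : topStratumPrime iotaOrdEpsTau S f = maximalIdeal S) : ¬ IsMonomialType f := by
  rintro ⟨v, g, n, hv, hg, hg2, hfeq⟩
  have hdim' : ringKrullDim S ≤ 3 := by rw [hdim]; exact le_of_eq (by norm_cast)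
  have hn : 0 < n := by
    rcases Nat.eq_zero_or_pos n with rfl | h
    · rw [pow_zero, mul_one] at hfeq
      exact absurd (hfeq ▸ hf) (IsLocalRing.notMem_maximalIdeal.mpr hv)
    · exact h
  obtain ⟨-, hε, hτ⟩ := JOpenLE3.letters_of_eq_unit_mul_pow S hdim' hv hg hg2 hn hfeq
  have hntie : ¬ IsTiePosition S f := (iotaTau_eq_zero_iff_not_isTiePosition hdim' f).mp hτ
  haveI : (Ideal.span {g}).IsPrime := (IotaOrderStrat.strat_of_eq_unit_mul_pow hv hg hg2 hn hfeq).1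
  have hE : topStratum iotaOrdEps S f = {𝔮 | Ideal.span {g} ≤ 𝔮.asIdeal} := by
    rw [topStratum_iotaOrdEps_eq_topStratum_iotaOrd_of_iotaEps_eq_zero hf hε, topStratum_iotaOrd_of_eq_unit_mul_pow hv hg hg2 hn hfeq]
  have h𝔪g : maximalIdeal S = Ideal.span {g} := by
    rw [← htop, topStratumPrime_iotaOrdEpsTau_eq_of_not_isTiePosition hdim' hntie,
      ContactCylinder.topStratumPrime_eq_of_topStratum_eq iotaOrdEps S f hE]
  -- a principal maximal ideal has height `≤ 1` (Krull), contradicting `dim S = 3`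
  have hht : (maximalIdeal S).height ≤ 1 := by
    rw [h𝔪g]
    refine Ideal.height_le_one_of_isPrincipal_of_mem_minimalPrimes (Ideal.span {g}) (Ideal.span {g}) ?_
    rw [Ideal.minimalPrimes_eq_subsingleton_self]
    exact Set.mem_singleton _
  have h1 : ringKrullDim S ≤ 1 := by
    rw [← IsLocalRing.maximalIdeal_height_eq_ringKrullDim]
    exact_mod_cast hht
  have hdim3 : ringKrullDim S = 3 := by rw [hdim]; norm_cast
  rw [hdim3] at h1
  exact absurd h1 (by decide)

/-! ## §2 (o70-a) modulo the uniform level bound (EX-4) -/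

/-- **(o70-a) `SigmaMaximiserExistsLE3Body p` (SPEC (Δ12) l.131, conclusion `SigmaMaximiserExistsAt f` spelled out) FROM THE UNIFORM LEVEL
BOUND (EX-4)** — `hlev`: at every such position some `L` bounds `r₁ ≤ L q` for the two-flags reaching a maximal-ratio admissible triple.
Route: `RatContact.exists_isSigmaMaximiser_of_levelBound` (ratio maximum attained + discreteness + primitive rescaling), excellence from
`IsExcellentRing.of_essFiniteType`, not-of-monomial-type from §1. [OURS · L1 W4.3 · (o70-a) modulo (EX-4)] -/
theorem sigmaMaximiserExistsLE3_of_levelBound (p : ℕ)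
    (hlev : ∀ (k₀ : Type) [Field k₀] [CharP k₀ p] [PerfectField k₀]
      (S : Type) [CommRing S] [Algebra k₀ S] [Algebra.EssFiniteType k₀ S] [IsRegularLocalRing S] (f : S),
      ringKrullDim S = (3 : ℕ) → f ≠ 0 → f ∈ (maximalIdeal S) ^ 2 →
      topStratumPrime iotaOrdEpsTau S f = maximalIdeal S → iotaEps S f ≠ 1 →
      ∃ L : ℕ, ∀ (g₁ g₂ : S) (q r₁ r₂ : ℕ), AdmissibleTriple q r₁ r₂ → IsTwoFlag g₁ g₂ →
        f ∈ flagContactFiltration g₁ g₂ q r₁ r₂ (r₁ * (adicOrder f).toNat) →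
        (∀ q' r₁' r₂' : ℕ, AdmissibleTriple q' r₁' r₂' → FlagReaches f (adicOrder f).toNat q' r₁' r₂' → r₁' * r₂ ≤ r₁ * r₂') →
        r₁ ≤ L * q) :
    ∀ (k₀ : Type) [Field k₀] [CharP k₀ p] [PerfectField k₀]
      (S : Type) [CommRing S] [Algebra k₀ S] [Algebra.EssFiniteType k₀ S] [IsRegularLocalRing S] (f : S),
      ringKrullDim S = (3 : ℕ) → f ≠ 0 → f ∈ (maximalIdeal S) ^ 2 →
      topStratumPrime iotaOrdEpsTau S f = maximalIdeal S → iotaEps S f ≠ 1 →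
      ∃ (g₁ g₂ : S) (q r₁ r₂ : ℕ), IsSigmaMaximiser f (adicOrder f).toNat g₁ g₂ q r₁ r₂ ∧ IsPrimitiveTriple q r₁ r₂ := by
  intro k₀ _ _ _ S _ _ _ _ f hdim hf0 hf2 htop hε
  obtain ⟨L, hL⟩ := hlev k₀ S f hdim hf0 hf2 htop hε
  have hk : IsExcellentRing k₀ := Stacks07QW_field_holds k₀ k₀ inferInstance
  have hS : IsExcellentRing S := hk.of_essFiniteType ‹_›
  have hnm : ¬ IsMonomialType f :=
    not_isMonomialType_of_topStratumPrime_eq_maximalIdeal hdim (Ideal.pow_le_self two_ne_zero hf2) htop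
  have hdim3 : ringKrullDim S = 3 := by rw [hdim]; norm_cast
  exact RatContact.exists_isSigmaMaximiser_of_levelBound hS hdim3 hf0 hf2 hnm L hL

/-! ## §3 (σ-pres)₃ modulo (EX-4) and (J-can) -/

section Canonical

variable {S : Type} [CommRing S] [IsLocalRing S]

/-- **`jSigmaPtLocal` IS the filtration of any σ-attaining primitive flag, given canonicity at `(S, f)`** (the sup of a constant family over a
non-empty index; SPEC (Δ12) `jSigmaPtLocal_eq_flagContactFiltration_of_canonicalAt`, canonicity spelled out). [OURS · SPEC (Δ12)] -/
theorem jSigmaPtLocal_eq_flagContactFiltration_of_canonical {f : S} (hf0 : f ≠ 0) (hfu : ¬ IsUnit f)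
    (hcan : ∀ (g₁ g₂ : S) (q r₁ r₂ : ℕ) (g₁' g₂' : S) (q' r₁' r₂' : ℕ),
      IsSigmaMaximiser f (adicOrder f).toNat g₁ g₂ q r₁ r₂ → IsPrimitiveTriple q r₁ r₂ →
      IsSigmaMaximiser f (adicOrder f).toNat g₁' g₂' q' r₁' r₂' → IsPrimitiveTriple q' r₁' r₂' →
      ∀ m : ℕ, flagContactFiltration g₁' g₂' q' r₁' r₂' m = flagContactFiltration g₁ g₂ q r₁ r₂ m)
    {g₁ g₂ : S} {q r₁ r₂ : ℕ} (hmax : IsSigmaMaximiser f (adicOrder f).toNat g₁ g₂ q r₁ r₂) (hprim : IsPrimitiveTriple q r₁ r₂) (m : ℕ) :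
    jSigmaPtLocal f m = flagContactFiltration g₁ g₂ q r₁ r₂ m := by
  rw [jSigmaPtLocal_of_ne hf0 hfu]
  refine le_antisymm ?_ ?_
  · exact iSup_le fun g₁' => iSup_le fun g₂' => iSup_le fun q' => iSup_le fun r₁' => iSup_le fun r₂' => iSup_le fun h' =>
      (hcan g₁ g₂ q r₁ r₂ g₁' g₂' q' r₁' r₂' hmax hprim h'.1 h'.2 m).le
  · exact le_iSup_of_le g₁ <| le_iSup_of_le g₂ <| le_iSup_of_le q <| le_iSup_of_le r₁ <| le_iSup_of_le r₂ <|
      le_iSup_of_le ⟨hmax, hprim⟩ le_rfl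

/-- **`J₃ᵗ` at a dimension-3, `ε ≠ 1` point-centre position is the weighted monomial filtration `(x, g₂, g₁ ; q, r₂, r₁)` of any σ-attaining
primitive flag completed to a minimal generating triple, given canonicity** (SPEC (Δ12) `jFlatT_eq_weightedMonomialIdeal_of_canonicalAt`:
`jFlatT_eq_jSigmaPt` + the lemma above + res-type-070's bridge `flagContactFiltration_eq_weightedMonomialIdeal`). [OURS · SPEC (Δ12)]
[cite: Wlodarczyk2022, Lemma 2.1.12] -/
theorem jFlatT_eq_weightedMonomialIdeal_of_canonical {f : S} (hf0 : f ≠ 0) (hfu : ¬ IsUnit f)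
    (h : topStratumPrime iotaOrdEpsTau S f = maximalIdeal S) (hdim : ¬ ringKrullDim S ≤ 2) (hε : iotaEps S f ≠ 1)
    (hcan : ∀ (g₁ g₂ : S) (q r₁ r₂ : ℕ) (g₁' g₂' : S) (q' r₁' r₂' : ℕ),
      IsSigmaMaximiser f (adicOrder f).toNat g₁ g₂ q r₁ r₂ → IsPrimitiveTriple q r₁ r₂ →
      IsSigmaMaximiser f (adicOrder f).toNat g₁' g₂' q' r₁' r₂' → IsPrimitiveTriple q' r₁' r₂' →
      ∀ m : ℕ, flagContactFiltration g₁' g₂' q' r₁' r₂' m = flagContactFiltration g₁ g₂ q r₁ r₂ m)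
    {x g₁ g₂ : S} {q r₁ r₂ : ℕ} (hmax : IsSigmaMaximiser f (adicOrder f).toNat g₁ g₂ q r₁ r₂) (hprim : IsPrimitiveTriple q r₁ r₂)
    (h𝔪 : Ideal.span {x, g₂, g₁} = maximalIdeal S) (m : ℕ) :
    jFlatT S f m = weightedMonomialIdeal ![x, g₂, g₁] ![q, r₂, r₁] m := by
  rw [jFlatT_eq_jSigmaPt S f m h hdim hε, jSigmaPt_eq, jSigmaPtLocal_eq_flagContactFiltration_of_canonical hf0 hfu hcan hmax hprim m]
  exact flagContactFiltration_eq_weightedMonomialIdeal h𝔪 hmax.1.1 hmax.1.2.1 (hmax.1.2.1.trans hmax.1.2.2) m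

end Canonical

/-- **(σ-pres)₃ `SigmaPresentationLE3Body p` (SPEC (Δ12) l.147 = the `hσ` of the point bodies p560019 / p562344, VERBATIM) FROM (EX-4) AND
(J-can)** — the registrar's glue `sigmaPresentationLE3Body_of_bodies` with (o70-a) replaced by its proof modulo (EX-4)
(`sigmaMaximiserExistsLE3_of_levelBound`), (o70-b) = `hcan` (res-D-brk-1's `JSigmaCanonicalLE3Body p` body VERBATIM) and (o70-x) =
res-D-pv-048's `Iota3.exists_span_triple_of_isTwoFlag` (p562089).  With this and the point bodies:
h8 ⟸ {(Δ10-d) ✓, (P₁₀) ✓, (EX-4), (J-can)}. [OURS · L1 W4.3 · (σ-pres)₃ closer] [cite: Wlodarczyk2022, Lemma 2.1.12] -/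
theorem sigmaPresentationLE3_of_levelBound_of_canonical (p : ℕ)
    (hlev : ∀ (k₀ : Type) [Field k₀] [CharP k₀ p] [PerfectField k₀]
      (S : Type) [CommRing S] [Algebra k₀ S] [Algebra.EssFiniteType k₀ S] [IsRegularLocalRing S] (f : S),
      ringKrullDim S = (3 : ℕ) → f ≠ 0 → f ∈ (maximalIdeal S) ^ 2 →
      topStratumPrime iotaOrdEpsTau S f = maximalIdeal S → iotaEps S f ≠ 1 →
      ∃ L : ℕ, ∀ (g₁ g₂ : S) (q r₁ r₂ : ℕ), AdmissibleTriple q r₁ r₂ → IsTwoFlag g₁ g₂ →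
        f ∈ flagContactFiltration g₁ g₂ q r₁ r₂ (r₁ * (adicOrder f).toNat) →
        (∀ q' r₁' r₂' : ℕ, AdmissibleTriple q' r₁' r₂' → FlagReaches f (adicOrder f).toNat q' r₁' r₂' → r₁' * r₂ ≤ r₁ * r₂') →
        r₁ ≤ L * q)
    (hcan : ∀ (k₀ : Type) [Field k₀] [CharP k₀ p] [PerfectField k₀]
      (S : Type) [CommRing S] [Algebra k₀ S] [Algebra.EssFiniteType k₀ S] [IsRegularLocalRing S] (f : S),
      ringKrullDim S = (3 : ℕ) → f ≠ 0 → f ∈ (maximalIdeal S) ^ 2 →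
      topStratumPrime iotaOrdEpsTau S f = maximalIdeal S → iotaEps S f ≠ 1 →
      ∀ (g₁ g₂ : S) (q r₁ r₂ : ℕ) (g₁' g₂' : S) (q' r₁' r₂' : ℕ),
        IsSigmaMaximiser f (adicOrder f).toNat g₁ g₂ q r₁ r₂ → IsPrimitiveTriple q r₁ r₂ →
        IsSigmaMaximiser f (adicOrder f).toNat g₁' g₂' q' r₁' r₂' → IsPrimitiveTriple q' r₁' r₂' →
        ∀ m : ℕ, flagContactFiltration g₁' g₂' q' r₁' r₂' m = flagContactFiltration g₁ g₂ q r₁ r₂ m) :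
    ∀ (k₀ : Type) [Field k₀] [CharP k₀ p] [PerfectField k₀]
      (S : Type) [CommRing S] [Algebra k₀ S] [Algebra.EssFiniteType k₀ S] [IsRegularLocalRing S] (f : S),
      ringKrullDim S = (3 : ℕ) → f ≠ 0 → f ∈ (maximalIdeal S) ^ 2 →
      topStratumPrime iotaOrdEpsTau S f = maximalIdeal S → iotaEps S f = 0 →
      ∃ (n : ℕ) (u : Fin n → S) (w : Fin n → ℕ),
        Ideal.span (Set.range u) = maximalIdeal S ∧ (maximalIdeal S).spanFinrank = n ∧ (∀ i, 0 < w i) ∧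
        ∀ m : ℕ, weightedMonomialIdeal u w m = jFlatT S f m := by
  intro k₀ _ _ _ S _ _ _ _ f hdim hf0 hf2 htop hε
  have hε' : iotaEps S f ≠ 1 := by rw [hε]; exact zero_ne_one
  obtain ⟨g₁, g₂, q, r₁, r₂, hmax, hprim⟩ := sigmaMaximiserExistsLE3_of_levelBound p hlev k₀ S f hdim hf0 hf2 htop hε'
  obtain ⟨x, h𝔪, h3⟩ := exists_span_triple_of_isTwoFlag S hdim g₁ g₂ hmax.2.1
  have hfu : ¬ IsUnit f := (IsLocalRing.mem_maximalIdeal _).mp (Ideal.pow_le_self two_ne_zero hf2)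
  have hd : ¬ ringKrullDim S ≤ 2 := by rw [hdim]; decide
  refine ⟨3, ![x, g₂, g₁], ![q, r₂, r₁], by rw [range_vec₃, h𝔪], h3, ?_, fun m =>
    (jFlatT_eq_weightedMonomialIdeal_of_canonical hf0 hfu htop hd hε' (hcan k₀ S f hdim hf0 hf2 htop hε') hmax hprim h𝔪 m).symm⟩
  intro i
  fin_cases i
  · exact hmax.1.pos.1
  · exact hmax.1.pos.2.1
  · exact hmax.1.pos.2.2

end Iota3

end Summit.ResolutionOfSingularities.ResolutionOfSingularities.Cruxes.HypersurfaceCentreConstruction.LocalEngine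

end
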